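import Literature.Topology.FourManifolds.TorusCoordinates
import Mathlib.Analysis.SpecialFunctions.Sqrt
import Mathlib.Analysis.SpecialFunctions.SmoothTransition
import Mathlib.Analysis.InnerProductSpace.Calculus
import HarnessLib

/-!
# Coordinates for the fishtail configuration in the shear model: the cap chart and the corner chart

Pure real/complex analysis (no manifolds) underlying the embedding of the model of the fishtail
end (`FishtailEndModel.lean`) into the straightened Cappell–Shaneson model
(`GompfShearModel.lean`), i.e. the geometric core of R. Gompf, *More Cappell–Shaneson spheres are
standard*, Algebr. Geom. Topol. 10 (2010), Thm 2.1 / Lemma 2.2 (the punctured torus `F`, the box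
`N`, the disc `D` and the fishtail neighbourhood `Φ = N ∪ 2-handle`). Two coordinate systems:

* **The cap chart.** Surgery on the section circle replaces the tube `𝕊¹ × B³` by `D² × 𝕊²`
  with the *same* radial parameter `t` (`circleSurgeryRel`); for the product tube of radius `ε`
  (`univBall 0 ε`) the physical coordinate along the first axis is `n = ε t / √(1 + t²)`. The
  functions `Literature.Topology.FourManifolds.capRad ε n = -n / √(ε² - n²)` and
  `Literature.Topology.FourManifolds.capLat ε t = -ε t / √(1 + t²)` are mutually inverse
  (`capLat_capRad`, `capRad_capLat`), smooth, and turn the north cap of the surgered section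
  surface into the polar chart `d = t(n) e^{2πis}` (`Literature.Topology.FourManifolds.capPt`,
  inverse `capN`, `capS` on the sector `s ∈ (1/2, 1)`).
* **The corner chart** `Literature.Topology.FourManifolds.cornerChart` around the boundary circle
  `γ` of Gompf's disc: coordinates `(ℓ, w, e) ∈ ℝ × ℂ × ℝ` ↦ `(n, s, y, ℓ)` with
  `t(ñ) e^{2πis̃} = d₀ + e^{iℓ} (w + U(y))`, `s = s⋆ + (1 - m e)(s̃ - s⋆)`, `y = y⋆ - h e`:
  the box `N` is `{e ≥ 0}` with its shell radial (`m e = e` for `e ≥ e₀`), the disc is `{w = 0}`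
  (cross-sections circles of radius `U(y)` in the cap chart), and on `∂N = {e = 0}` the product
  coordinates of `∂N` are the cap-chart offset `e^{iℓ} w` — the rotation `e^{iℓ}` is the `±1`
  framing of Lemma 2.2. The chart has the explicit inverse
  `Literature.Topology.FourManifolds.cornerChartInv` (`cornerChartInv_cornerChart`,
  `cornerChart_cornerChartInv`) and both are smooth on their open domains.

The profile `U` and the clamp `m` are arbitrary smooth functions with `1 - m e ≠ 0`; the standard
choices `Literature.Topology.FourManifolds.fishU`, `Literature.Topology.FourManifolds.fishClamp`
(smooth-transition based: `U ≡ 0` below a height, `m e = 0` for `e ≤ 0`, `m e = e` for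
`e ≥ e₀`) are provided with their properties. Everything is proved; no named facts.

## References

* R. E. Gompf, *More Cappell–Shaneson spheres are standard*, Algebr. Geom. Topol. 10 (2010)
  1665–1681: proof of Thm 2.1 (the box `N`, the punctured torus `F′`, the disc `D`) and Lemma 2.2.
  [GompfAGT2010]
-/

noncomputable section

open scoped Real ContDiff Topology
open Set Function Complex

namespace Literature.Topology.FourManifolds

/-! ### The radial parameter of the cap and its inverse -/

section Cap

variable {ε : ℝ}

/-- **The radial parameter of the north cap**: `t(n) = -n / √(ε² - n²)`, the surgery piece's own
radial coordinate at the point of the section surface with first physical coordinate `n`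
(`n = -ε t/√(1 + t²)` for the product tube `univBall 0 ε`); an odd increasing diffeomorphism
`(-ε, ε) → ℝ` (only `n < 0` is the north cap). [cite: GompfAGT2010, Thm 2.1 (proof: surgery on C performed pairwise turns F′ into the disc D)] -/
def capRad (ε n : ℝ) : ℝ := -n / Real.sqrt (ε ^ 2 - n ^ 2)

/-- **The inverse of the radial parameter**: `n(t) = -ε t / √(1 + t²)`. [folklore] -/
def capLat (ε t : ℝ) : ℝ := -ε * t / Real.sqrt (1 + t ^ 2)

/-- `n(t)² < ε²` for `ε > 0`: the inverse lands in `(-ε, ε)`. [folklore] -/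
theorem capLat_sq_lt (hε : 0 < ε) (t : ℝ) : capLat ε t ^ 2 < ε ^ 2 := by
  have h1 : 0 < 1 + t ^ 2 := (by positivity : (0 : ℝ) < 1 + t ^ 2)
  have h2 : Real.sqrt (1 + t ^ 2) ^ 2 = 1 + t ^ 2 := Real.sq_sqrt h1.le
  have h3 : 0 < Real.sqrt (1 + t ^ 2) := Real.sqrt_pos.2 h1
  rw [capLat, div_pow, mul_pow, neg_sq, h2, div_lt_iff₀ h1]
  nlinarith [sq_nonneg t, sq_pos_of_pos hε]

/-- `|n(t)| < ε`. [folklore] -/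
theorem abs_capLat_lt (hε : 0 < ε) (t : ℝ) : |capLat ε t| < ε :=
  abs_lt_of_sq_lt_sq (capLat_sq_lt hε t) hε.le

/-- `ε² - n(t)² = ε²/(1 + t²)`. [folklore] -/
theorem sq_sub_capLat_sq (ε t : ℝ) : ε ^ 2 - capLat ε t ^ 2 = ε ^ 2 / (1 + t ^ 2) := by
  have h1 : 0 < 1 + t ^ 2 := (by positivity : (0 : ℝ) < 1 + t ^ 2)
  have h2 : Real.sqrt (1 + t ^ 2) ^ 2 = 1 + t ^ 2 := Real.sq_sqrt h1.le
  rw [capLat, div_pow, mul_pow, neg_sq, h2]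
  field_simp
  ring

/-- **`t(n(t)) = t`.** [folklore] -/
theorem capRad_capLat (hε : 0 < ε) (t : ℝ) : capRad ε (capLat ε t) = t := by
  have h1 : 0 < 1 + t ^ 2 := (by positivity : (0 : ℝ) < 1 + t ^ 2)
  have h3 : 0 < Real.sqrt (1 + t ^ 2) := Real.sqrt_pos.2 h1
  rw [capRad, sq_sub_capLat_sq, Real.sqrt_div' _ h1.le, Real.sqrt_sq hε.le, capLat]
  field_simp

/-- **`n(t(n)) = n`** for `|n| < ε`. [folklore] -/
theorem capLat_capRad (hε : 0 < ε) {n : ℝ} (hn : n ^ 2 < ε ^ 2) : capLat ε (capRad ε n) = n := by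
  have h1 : 0 < ε ^ 2 - n ^ 2 := by linarith
  have h2 : 0 < Real.sqrt (ε ^ 2 - n ^ 2) := Real.sqrt_pos.2 h1
  have h3 : Real.sqrt (ε ^ 2 - n ^ 2) ^ 2 = ε ^ 2 - n ^ 2 := Real.sq_sqrt h1.le
  have h4 : 1 + capRad ε n ^ 2 = ε ^ 2 / (ε ^ 2 - n ^ 2) := by
    rw [capRad, div_pow, neg_sq, h3]
    field_simp
    ring
  rw [capLat, h4, Real.sqrt_div' _ h1.le, Real.sqrt_sq hε.le, capRad]
  field_simp

/-- `t(n) ≥ 0` iff `n ≤ 0` (for `|n| < ε`): the north cap is `n ≤ 0`. [folklore] -/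
theorem capRad_nonneg {n : ℝ} (hn0 : n ≤ 0) : 0 ≤ capRad ε n :=
  div_nonneg (by linarith) (Real.sqrt_nonneg _)

/-- `t(n) > 0` for `-ε < n < 0`. [folklore] -/
theorem capRad_pos {n : ℝ} (hn : n ^ 2 < ε ^ 2) (hn0 : n < 0) : 0 < capRad ε n :=
  div_pos (by linarith) (Real.sqrt_pos.2 (by linarith))

/-- `n(t) < 0` for `t > 0` (and `ε > 0`). [folklore] -/
theorem capLat_neg (hε : 0 < ε) {t : ℝ} (ht : 0 < t) : capLat ε t < 0 := by
  rw [capLat]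
  exact div_neg_of_neg_of_pos (by nlinarith) (Real.sqrt_pos.2 ((by positivity : (0 : ℝ) < 1 + t ^ 2)))

/-- **`t` is smooth on `(-ε, ε)`.** [folklore] -/
theorem contDiffOn_capRad (ε : ℝ) : ContDiffOn ℝ ∞ (capRad ε) {n | n ^ 2 < ε ^ 2} := by
  have h : ∀ n ∈ {n : ℝ | n ^ 2 < ε ^ 2}, ε ^ 2 - n ^ 2 ≠ 0 := fun n hn ↦ by
    have : n ^ 2 < ε ^ 2 := hn; linarith
  refine contDiff_neg.contDiffOn.div ?_ fun n hn ↦ (Real.sqrt_pos.2 (by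
    have : n ^ 2 < ε ^ 2 := hn; linarith)).ne'
  exact (contDiffOn_const.sub (contDiff_id.pow 2).contDiffOn).sqrt h

/-- `t` is smooth at every point of `(-ε, ε)`. [folklore] -/
theorem contDiffAt_capRad {n : ℝ} (hn : n ^ 2 < ε ^ 2) : ContDiffAt ℝ ∞ (capRad ε) n :=
  (contDiffOn_capRad ε).contDiffAt ((isOpen_lt (continuous_id.pow 2) continuous_const).mem_nhds hn)

/-- **`n` is smooth on `ℝ`.** [folklore] -/
theorem contDiff_capLat (ε : ℝ) : ContDiff ℝ ∞ (capLat ε) := by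
  refine (contDiff_const.mul contDiff_id).div ?_ fun t ↦ (Real.sqrt_pos.2 ((by positivity : (0 : ℝ) < 1 + t ^ 2))).ne'
  exact (contDiff_const.add (contDiff_id.pow 2)).sqrt fun t ↦ ((by positivity : (0 : ℝ) < 1 + t ^ 2)).ne'

/-! ### The polar cap chart `d = t(n) e^{2πis}` -/

/-- **The cap chart**: `d(n, s) = t(n) e^{2πis} ∈ ℂ` (the surgery disc coordinate of the point of
the north cap with physical coordinates `(n, s)`, extended to the whole region `-ε < n < 0`). [folklore] -/
def capPt (ε n s : ℝ) : ℂ := (capRad ε n : ℂ) * exp (2 * π * s * I)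

/-- **The latitude of a chart point**: `n = n(|d|)`. [folklore] -/
def capN (ε : ℝ) (d : ℂ) : ℝ := capLat ε ‖d‖

/-- **The base coordinate of a chart point** on the sector `s ∈ (1/2, 1)`:
`s = arg d / 2π + 1`. [folklore] -/
def capS (d : ℂ) : ℝ := arg d / (2 * π) + 1

/-- `|d(n, s)| = t(n)` for `n ≤ 0`. [folklore] -/
theorem norm_capPt {n : ℝ} (hn0 : n ≤ 0) (s : ℝ) :
    ‖capPt ε n s‖ = capRad ε n := by
  rw [capPt, norm_mul, Complex.norm_real, Real.norm_eq_abs, abs_of_nonneg (capRad_nonneg hn0),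
    show (2 * π * s * I : ℂ) = ↑(2 * π * s) * I by push_cast; ring, norm_exp_ofReal_mul_I, mul_one]

/-- **`n(d(n, s)) = n`.** [folklore] -/
theorem capN_capPt (hε : 0 < ε) {n : ℝ} (hn : n ^ 2 < ε ^ 2) (hn0 : n ≤ 0) (s : ℝ) :
    capN ε (capPt ε n s) = n := by
  rw [capN, norm_capPt hn0, capLat_capRad hε hn]

/-- `arg d(n, s) = 2πs - 2π` for `-ε < n < 0` and `s ∈ (1/2, 1)`. [folklore] -/
theorem arg_capPt {n : ℝ} (hn : n ^ 2 < ε ^ 2) (hn0 : n < 0) {s : ℝ} (hs1 : 1 / 2 < s) (hs2 : s < 1) :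
    arg (capPt ε n s) = 2 * π * s - 2 * π := by
  have ht : 0 < capRad ε n := capRad_pos hn hn0
  have hexp : exp (2 * π * s * I) = exp (↑(2 * π * s - 2 * π) * I) := by
    rw [show (↑(2 * π * s - 2 * π) : ℂ) * I = 2 * π * s * I - 2 * π * I by push_cast; ring,
      Complex.exp_sub, exp_two_pi_mul_I, div_one]
  rw [capPt, hexp, arg_real_mul _ ht, arg_exp_mul_I, toIocMod_eq_self]
  constructor <;> nlinarith [Real.pi_pos]

/-- **`s(d(n, s)) = s`** on the sector. [folklore] -/
theorem capS_capPt {n : ℝ} (hn : n ^ 2 < ε ^ 2) (hn0 : n < 0) {s : ℝ} (hs1 : 1 / 2 < s) (hs2 : s < 1) :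
    capS (capPt ε n s) = s := by
  rw [capS, arg_capPt hn hn0 hs1 hs2]
  field_simp
  ring

/-- **`d(n(d), s(d)) = d`** (for `ε > 0`). [folklore] -/
theorem capPt_capN_capS (hε : 0 < ε) (d : ℂ) : capPt ε (capN ε d) (capS d) = d := by
  rw [capPt, capN, capRad_capLat hε, capS]
  have h2 : (2 * (π : ℂ) * ((arg d / (2 * π) + 1 : ℝ) : ℂ) * I) = (arg d : ℂ) * I + 2 * π * I := by
    push_cast
    field_simp
  rw [h2, Complex.exp_add, exp_two_pi_mul_I, mul_one]
  exact norm_mul_exp_arg_mul_I d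

/-- The cap chart is smooth in `(n, s)` on `(-ε, ε) × ℝ`. [folklore] -/
theorem contDiffOn_capPt (ε : ℝ) :
    ContDiffOn ℝ ∞ (fun p : ℝ × ℝ ↦ capPt ε p.1 p.2) {p | p.1 ^ 2 < ε ^ 2} := by
  have h1 : ContDiffOn ℝ ∞ (fun p : ℝ × ℝ ↦ (capRad ε p.1 : ℂ)) {p | p.1 ^ 2 < ε ^ 2} :=
    ofRealCLM.contDiff.comp_contDiffOn ((contDiffOn_capRad ε).comp contDiff_fst.contDiffOn fun p hp ↦ hp)
  have h2 : ContDiff ℝ ∞ fun p : ℝ × ℝ ↦ exp (2 * π * p.2 * I) := by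
    have : ContDiff ℝ ∞ fun p : ℝ × ℝ ↦ (2 * π * p.2 * I : ℂ) :=
      ((contDiff_const.mul (ofRealCLM.contDiff.comp contDiff_snd)).mul contDiff_const)
    exact Complex.contDiff_exp.comp this
  exact h1.mul h2.contDiffOn

/-- The latitude `capN` is smooth off `0`. [folklore] -/
theorem contDiffAt_capN (ε : ℝ) {d : ℂ} (hd : d ≠ 0) : ContDiffAt ℝ ∞ (capN ε) d :=
  (contDiff_capLat ε).contDiffAt.comp d (contDiffAt_norm ℝ hd)

/-- The base coordinate `capS` is smooth on the slit plane. [folklore] -/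
theorem contDiffAt_capS {d : ℂ} (hd : d ∈ slitPlane) : ContDiffAt ℝ ∞ capS d :=
  ((contDiffAt_arg hd).div_const _).add contDiffAt_const

end Cap

/-! ### The corner chart around the boundary circle of the disc -/

section Corner

variable (ε : ℝ) (d₀ : ℂ) (sc yc h : ℝ) (U m : ℝ → ℝ)

/-- **The corner chart** `(ℓ, w, e) ↦ (n, s, y, ℓ)`: with `y = y⋆ - h e` and
`D = d₀ + e^{iℓ} (w + U y)` in the cap chart, `n = n(D)`, `s = s⋆ + (1 - m e)(s(D) - s⋆)`.
On `{e ≥ e₀}` (where `m e = e`) the lines `{w = e^{-iℓ} v, e}` are the radial shell of the box `N`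
over the base point with cap coordinate `d₀ + v`; `{w = 0, e < 0}` is the disc collar with circular
cross-sections of radius `U(y)` about `d₀`; on `∂N = {e = 0}` the cap-chart offset of the point is
`e^{iℓ} w` — the product coordinates of `∂N` rotated once along the circle `γ = {w = 0, e = 0}`,
i.e. the `±1` framing of Gompf's Lemma 2.2. [cite: GompfAGT2010, Lemma 2.2 (the normal framing of D differs from the product framing on ∂D ⊂ ∂N by ±1 twist)] -/
def cornerChart (p : ℝ × ℂ × ℝ) : ℝ × ℝ × ℝ × ℝ :=
  let y := yc - h * p.2.2
  let D := d₀ + exp (p.1 * I) * (p.2.1 + U y)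
  (capN ε D, sc + (1 - m p.2.2) * (capS D - sc), y, p.1)

/-- The cap-chart point of the corner chart. [folklore] -/
def cornerD (p : ℝ × ℂ × ℝ) : ℂ := d₀ + exp (p.1 * I) * (p.2.1 + U (yc - h * p.2.2))

/-- **The inverse corner chart** `(n, s, y, ℓ) ↦ (ℓ, w, e)`: `e = (y⋆ - y)/h`,
`s̃ = s⋆ + (s - s⋆)/(1 - m e)`, `w = e^{-iℓ} (d(n, s̃) - d₀) - U y` (the sign of the rotation is
the one forced by the winding `+1` of the section of the model surface about the puncture in the
cap chart, whose orientation is opposite to that of the `(n, s)`-coordinates). [folklore] -/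
def cornerChartInv (q : ℝ × ℝ × ℝ × ℝ) : ℝ × ℂ × ℝ :=
  let e := (yc - q.2.2.1) / h
  let s' := sc + (q.2.1 - sc) / (1 - m e)
  (q.2.2.2, exp (-(q.2.2.2 * I)) * (capPt ε q.1 s' - d₀) - U q.2.2.1, e)

variable {ε d₀ sc yc h U m}

/-- `e^{iℓ} e^{-iℓ} = 1`. [folklore] -/
theorem exp_mul_I_mul_exp_neg (ℓ : ℝ) : exp (ℓ * I) * exp (-(ℓ * I)) = 1 := by
  rw [← Complex.exp_add, add_neg_cancel, Complex.exp_zero]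

/-- `e^{-iℓ} e^{iℓ} = 1`. [folklore] -/
theorem exp_neg_mul_exp_mul_I (ℓ : ℝ) : exp (-(ℓ * I)) * exp (ℓ * I) = 1 := by
  rw [← Complex.exp_add, neg_add_cancel, Complex.exp_zero]

/-- The last coordinate of the corner chart is `ℓ` (definitional). [folklore] -/
@[simp] theorem cornerChart_snd_snd_snd (p : ℝ × ℂ × ℝ) :
    (cornerChart ε d₀ sc yc h U m p).2.2.2 = p.1 := rfl

/-- The height of the corner chart is `y⋆ - h e` (definitional). [folklore] -/
@[simp] theorem cornerChart_snd_snd_fst (p : ℝ × ℂ × ℝ) :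
    (cornerChart ε d₀ sc yc h U m p).2.2.1 = yc - h * p.2.2 := rfl

/-- The latitude of the corner chart (definitional). [folklore] -/
theorem cornerChart_fst (p : ℝ × ℂ × ℝ) :
    (cornerChart ε d₀ sc yc h U m p).1 = capN ε (cornerD d₀ yc h U p) := rfl

/-- The base coordinate of the corner chart (definitional). [folklore] -/
theorem cornerChart_snd_fst (p : ℝ × ℂ × ℝ) :
    (cornerChart ε d₀ sc yc h U m p).2.1 = sc + (1 - m p.2.2) * (capS (cornerD d₀ yc h U p) - sc) := rfl

/-- **`inverse ∘ chart = id`** where the clamp is nondegenerate and `h ≠ 0`. [folklore] -/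
theorem cornerChartInv_cornerChart (hε : 0 < ε) (hh : h ≠ 0) {p : ℝ × ℂ × ℝ}
    (hm : 1 - m p.2.2 ≠ 0) :
    cornerChartInv ε d₀ sc yc h U m (cornerChart ε d₀ sc yc h U m p) = p := by
  obtain ⟨ℓ, w, e⟩ := p
  have he : (yc - (yc - h * e)) / h = e := by field_simp; ring
  simp only [cornerChartInv, cornerChart, he]
  refine Prod.ext rfl (Prod.ext ?_ rfl)
  have hs : sc + (sc + (1 - m e) * (capS (cornerD d₀ yc h U (ℓ, w, e)) - sc) - sc) / (1 - m e) =
      capS (cornerD d₀ yc h U (ℓ, w, e)) := by field_simp; ring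
  show exp (-(ℓ * I)) * (capPt ε (capN ε (cornerD d₀ yc h U (ℓ, w, e)))
      (sc + (sc + (1 - m e) * (capS (cornerD d₀ yc h U (ℓ, w, e)) - sc) - sc) / (1 - m e)) - d₀) -
      U (yc - h * e) = w
  rw [hs, capPt_capN_capS hε, cornerD]
  simp only
  rw [add_sub_cancel_left, ← mul_assoc, exp_neg_mul_exp_mul_I, one_mul, add_sub_cancel_right]

/-- **`chart ∘ inverse = id`** on the north-cap sector: `-ε < n < 0`, `s̃ ∈ (1/2, 1)`, the clamp
nondegenerate and `h ≠ 0`. [folklore] -/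
theorem cornerChart_cornerChartInv (hε : 0 < ε) (hh : h ≠ 0) {q : ℝ × ℝ × ℝ × ℝ}
    (hn : q.1 ^ 2 < ε ^ 2) (hn0 : q.1 < 0) (hm : 1 - m ((yc - q.2.2.1) / h) ≠ 0)
    (hs1 : 1 / 2 < sc + (q.2.1 - sc) / (1 - m ((yc - q.2.2.1) / h)))
    (hs2 : sc + (q.2.1 - sc) / (1 - m ((yc - q.2.2.1) / h)) < 1) :
    cornerChart ε d₀ sc yc h U m (cornerChartInv ε d₀ sc yc h U m q) = q := by
  obtain ⟨n, s, y, ℓ⟩ := q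
  simp only at hn hn0 hm hs1 hs2
  have hy : yc - h * ((yc - y) / h) = y := by field_simp; ring
  have hD : cornerD d₀ yc h U (cornerChartInv ε d₀ sc yc h U m (n, s, y, ℓ)) =
      capPt ε n (sc + (s - sc) / (1 - m ((yc - y) / h))) := by
    simp only [cornerD, cornerChartInv, hy]
    rw [sub_add_cancel, ← mul_assoc, exp_mul_I_mul_exp_neg, one_mul, add_sub_cancel]
  refine Prod.ext ?_ (Prod.ext ?_ (Prod.ext ?_ rfl))
  · rw [cornerChart_fst, hD, capN_capPt hε hn hn0.le]
  · rw [cornerChart_snd_fst, hD, capS_capPt hn hn0 hs1 hs2]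
    show sc + (1 - m ((yc - y) / h)) * (sc + (s - sc) / (1 - m ((yc - y) / h)) - sc) = s
    field_simp
    ring
  · show yc - h * ((yc - y) / h) = y
    exact hy

/-- **The corner chart is smooth** where its cap-chart point lies in the slit plane (`U`, `m`
smooth). [folklore] -/
theorem contDiffOn_cornerChart (hU : ContDiff ℝ ∞ U) (hm : ContDiff ℝ ∞ m) :
    ContDiffOn ℝ ∞ (cornerChart ε d₀ sc yc h U m) {p | cornerD d₀ yc h U p ∈ slitPlane} := by
  have hy : ContDiff ℝ ∞ fun p : ℝ × ℂ × ℝ ↦ yc - h * p.2.2 :=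
    contDiff_const.sub (contDiff_const.mul (contDiff_snd.comp contDiff_snd))
  have hD : ContDiff ℝ ∞ (cornerD d₀ yc h U) := by
    unfold cornerD
    have h1 : ContDiff ℝ ∞ fun p : ℝ × ℂ × ℝ ↦ exp ((p.1 : ℂ) * I) :=
      Complex.contDiff_exp.comp ((ofRealCLM.contDiff.comp contDiff_fst).mul contDiff_const)
    have h2 : ContDiff ℝ ∞ fun p : ℝ × ℂ × ℝ ↦ p.2.1 + (U (yc - h * p.2.2) : ℂ) :=
      (contDiff_fst.comp contDiff_snd).add (ofRealCLM.contDiff.comp (hU.comp hy))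
    exact contDiff_const.add (h1.mul h2)
  intro p hp
  have hD0 : cornerD d₀ yc h U p ≠ 0 := slitPlane_ne_zero hp
  have hN : ContDiffWithinAt ℝ ∞ (fun p ↦ capN ε (cornerD d₀ yc h U p))
      {p | cornerD d₀ yc h U p ∈ slitPlane} p :=
    ((contDiffAt_capN ε hD0).comp p hD.contDiffAt).contDiffWithinAt
  have hS : ContDiffWithinAt ℝ ∞ (fun p ↦ capS (cornerD d₀ yc h U p))
      {p | cornerD d₀ yc h U p ∈ slitPlane} p :=
    ((contDiffAt_capS hp).comp p hD.contDiffAt).contDiffWithinAt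
  have hm' : ContDiffWithinAt ℝ ∞ (fun p : ℝ × ℂ × ℝ ↦ 1 - m p.2.2)
      {p | cornerD d₀ yc h U p ∈ slitPlane} p :=
    (contDiff_const.sub (hm.comp (contDiff_snd.comp contDiff_snd))).contDiffAt.contDiffWithinAt
  exact hN.prodMk ((contDiffWithinAt_const.add (hm'.mul (hS.sub contDiffWithinAt_const))).prodMk
    (hy.contDiffAt.contDiffWithinAt.prodMk contDiffWithinAt_fst))

/-- **The inverse corner chart is smooth** where `|n| < ε` and the clamp is nondegenerate. [folklore] -/
theorem contDiffOn_cornerChartInv (hU : ContDiff ℝ ∞ U) (hm : ContDiff ℝ ∞ m) :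
    ContDiffOn ℝ ∞ (cornerChartInv ε d₀ sc yc h U m)
      {q | q.1 ^ 2 < ε ^ 2 ∧ 1 - m ((yc - q.2.2.1) / h) ≠ 0} := by
  have he : ContDiff ℝ ∞ fun q : ℝ × ℝ × ℝ × ℝ ↦ (yc - q.2.2.1) / h :=
    (contDiff_const.sub (contDiff_fst.comp (contDiff_snd.comp contDiff_snd))).div_const _
  have hm1 : ContDiff ℝ ∞ fun q : ℝ × ℝ × ℝ × ℝ ↦ 1 - m ((yc - q.2.2.1) / h) :=
    contDiff_const.sub (hm.comp he)
  have hs' : ContDiffOn ℝ ∞ (fun q : ℝ × ℝ × ℝ × ℝ ↦ sc + (q.2.1 - sc) / (1 - m ((yc - q.2.2.1) / h)))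
      {q | q.1 ^ 2 < ε ^ 2 ∧ 1 - m ((yc - q.2.2.1) / h) ≠ 0} :=
    contDiffOn_const.add (((contDiff_fst.comp contDiff_snd).sub contDiff_const).contDiffOn.div
      hm1.contDiffOn fun q hq ↦ hq.2)
  have hP : ContDiffOn ℝ ∞ (fun q : ℝ × ℝ × ℝ × ℝ ↦
      capPt ε q.1 (sc + (q.2.1 - sc) / (1 - m ((yc - q.2.2.1) / h))))
      {q | q.1 ^ 2 < ε ^ 2 ∧ 1 - m ((yc - q.2.2.1) / h) ≠ 0} :=
    (contDiffOn_capPt ε).comp (contDiffOn_fst.prodMk hs') fun q hq ↦ hq.1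
  have hl : ContDiff ℝ ∞ fun q : ℝ × ℝ × ℝ × ℝ ↦ exp (-((q.2.2.2 : ℂ) * I)) :=
    Complex.contDiff_exp.comp ((ofRealCLM.contDiff.comp
      (contDiff_snd.comp (contDiff_snd.comp contDiff_snd))).mul contDiff_const).neg
  have hUy : ContDiff ℝ ∞ fun q : ℝ × ℝ × ℝ × ℝ ↦ (U q.2.2.1 : ℂ) :=
    ofRealCLM.contDiff.comp (hU.comp (contDiff_fst.comp (contDiff_snd.comp contDiff_snd)))
  refine (contDiff_snd.comp (contDiff_snd.comp contDiff_snd)).contDiffOn.prodMk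
    ((((hl.contDiffOn.mul (hP.sub contDiffOn_const)).sub hUy.contDiffOn)).prodMk he.contDiffOn)

end Corner

/-! ### Standard profile and clamp -/

section Standard

/-- **The standard disc profile** `U(y) = r λ((y - y₁)/h₂)`: zero for `y ≤ y₁` (the disc starts
as the vertical cylinder over the puncture), increasing to `r` at `y = y₁ + h₂`. [folklore] -/
def fishU (r y₁ h₂ y : ℝ) : ℝ := r * Real.smoothTransition ((y - y₁) / h₂)

/-- The profile is smooth. [folklore] -/
theorem contDiff_fishU (r y₁ h₂ : ℝ) : ContDiff ℝ ∞ (fishU r y₁ h₂) :=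
  contDiff_const.mul (Real.smoothTransition.contDiff.comp ((contDiff_id.sub contDiff_const).div_const _))

/-- Below `y₁` the profile vanishes. [folklore] -/
theorem fishU_of_le {r y₁ h₂ y : ℝ} (hh : 0 < h₂) (hy : y ≤ y₁) : fishU r y₁ h₂ y = 0 := by
  rw [fishU, Real.smoothTransition.zero_of_nonpos (div_nonpos_of_nonpos_of_nonneg (by linarith) hh.le),
    mul_zero]

/-- Above `y₁ + h₂` the profile is `r`. [folklore] -/
theorem fishU_of_ge {r y₁ h₂ y : ℝ} (hh : 0 < h₂) (hy : y₁ + h₂ ≤ y) : fishU r y₁ h₂ y = r := by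
  rw [fishU, Real.smoothTransition.one_of_one_le (by rw [le_div_iff₀ hh]; linarith), mul_one]

/-- **The standard clamp** `m(e) = e λ(e/e₀)`: `0` for `e ≤ 0`, `e` for `e ≥ e₀`. [folklore] -/
def fishClamp (e₀ e : ℝ) : ℝ := e * Real.smoothTransition (e / e₀)

/-- The clamp is smooth. [folklore] -/
theorem contDiff_fishClamp (e₀ : ℝ) : ContDiff ℝ ∞ (fishClamp e₀) :=
  contDiff_id.mul (Real.smoothTransition.contDiff.comp (contDiff_id.div_const _))

/-- For `e ≤ 0` the clamp is `0`. [folklore] -/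
theorem fishClamp_of_nonpos {e₀ e : ℝ} (he₀ : 0 < e₀) (he : e ≤ 0) : fishClamp e₀ e = 0 := by
  rw [fishClamp, Real.smoothTransition.zero_of_nonpos (div_nonpos_of_nonpos_of_nonneg he he₀.le),
    mul_zero]

/-- For `e ≥ e₀` the clamp is `e`. [folklore] -/
theorem fishClamp_of_ge {e₀ e : ℝ} (he₀ : 0 < e₀) (he : e₀ ≤ e) : fishClamp e₀ e = e := by
  rw [fishClamp, Real.smoothTransition.one_of_one_le (by rwa [le_div_iff₀ he₀, one_mul]), mul_one]

/-- `0 ≤ m e ≤ max e 0`, so `1 - m e > 0` for `e < 1`. [folklore] -/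
theorem one_sub_fishClamp_pos {e₀ e : ℝ} (he : e < 1) : 0 < 1 - fishClamp e₀ e := by
  rw [fishClamp]
  rcases le_or_gt e 0 with h | h
  · have : e * Real.smoothTransition (e / e₀) ≤ 0 :=
      mul_nonpos_of_nonpos_of_nonneg h (Real.smoothTransition.nonneg _)
    linarith
  · have : e * Real.smoothTransition (e / e₀) ≤ e :=
      mul_le_of_le_one_right h.le (Real.smoothTransition.le_one _)
    linarith

end Standard

end Literature.Topology.FourManifolds
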